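import Mathlib
import HarnessLib
import Summits.RiemannHypothesis.RiemannHypothesis.Theorems.IntegerScrewWalkTwoLevelsPrep

/-!
# Route `IntegerScrew` — algebra for the K-RUNG theorem (`IntegerScrewWalkLevels`): Gershgorin for quadratic forms,
# bilinear / norm bookkeeping over a finite set of test functions, and linear independence of `{1, φ_p : p ∈ P}`

* **`form_nonneg_of_diag_dominant`** — `B_ii ≥ Σ_{j≠i}(|B_ij| + |B_ji|)/2` for all `i` ⟹ `Σ_iΣ_j x_ix_jB_ij ≥ 0`;
* `form_ge_diag_sub_offdiag` — the quantitative form `≥ Σ_i x_i²(B_ii − offdiagonal row sum)` (gives linear independence);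
* `sum_bilinear_expand`, `sum_norm_expand` — `Σ_k (Σ_p a_pu_p)(Σ_q a_qT_q)/k` and `‖Σ_p a_pu_p + c‖²_π` as double sums;
* `parityFun_indep` — `Σ_p a_pφ_p + c ≡ 0` on `{1,…,M}` (primes `p ≤ M`) forces `a ≡ 0`, `c = 0`.

RH-free.  References: PIVOT-LAW §13.10 (iv), CONTINUUM-LIMIT §23.18 (rh-explicit A6-PIVOT); M. Suzuki, J. Lond. Math.
Soc. (2) 108 (2023) 1448–1487 [Suzuki2023].
-/

noncomputable section

set_option linter.dupNamespace false -- D-0017: `Summit.<S>.<S>.…` is the designed namespace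

namespace Summit.RiemannHypothesis.RiemannHypothesis.Theorems.IntegerScrew

open Finset ArithmeticFunction

/-! ### Algebraic lemmas -/

/-- **Gershgorin for quadratic forms**: if every diagonal entry dominates the symmetrised off-diagonal row sum,
the form `Σ_i Σ_j x_i x_j B_ij` is non-negative. -/
theorem form_nonneg_of_diag_dominant {ι : Type*} [DecidableEq ι] (s : Finset ι) (B : ι → ι → ℝ) (x : ι → ℝ)
    (h : ∀ i ∈ s, ∑ j ∈ s, (if i = j then (0 : ℝ) else (|B i j| + |B j i|) / 2) ≤ B i i) :
    0 ≤ ∑ i ∈ s, ∑ j ∈ s, x i * x j * B i j := by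
  have hlow : ∀ i ∈ s, ∀ j ∈ s,
      (if i = j then x i ^ 2 * B i i else -((x i ^ 2 * |B i j| + x j ^ 2 * |B i j|) / 2)) ≤ x i * x j * B i j := by
    intro i _ j _
    split_ifs with hij
    · subst hij; exact le_of_eq (by ring)
    · have hB : -(|x i| * |x j| * |B i j|) ≤ x i * x j * B i j := by
        rw [← abs_mul, ← abs_mul]; exact neg_abs_le _
      nlinarith [sq_nonneg (|x i| - |x j|), abs_nonneg (B i j), sq_abs (x i), sq_abs (x j),
        mul_nonneg (sq_nonneg (|x i| - |x j|)) (abs_nonneg (B i j))]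
  refine le_trans ?_ (Finset.sum_le_sum fun i hi => Finset.sum_le_sum fun j hj => hlow i hi j hj)
  have e1 : ∀ i ∈ s, ∑ j ∈ s, (if i = j then x i ^ 2 * B i i else -((x i ^ 2 * |B i j| + x j ^ 2 * |B i j|) / 2)) =
      x i ^ 2 * B i i - ∑ j ∈ s, (if i = j then (0 : ℝ) else x i ^ 2 * |B i j| / 2)
        - ∑ j ∈ s, (if i = j then (0 : ℝ) else x j ^ 2 * |B i j| / 2) := by
    intro i hi
    have e : ∀ j ∈ s, (if i = j then x i ^ 2 * B i i else -((x i ^ 2 * |B i j| + x j ^ 2 * |B i j|) / 2)) =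
        (if i = j then x i ^ 2 * B i i else 0) - (if i = j then (0 : ℝ) else x i ^ 2 * |B i j| / 2)
          - (if i = j then (0 : ℝ) else x j ^ 2 * |B i j| / 2) := by
      intro j _; split_ifs <;> ring
    rw [Finset.sum_congr rfl e, Finset.sum_sub_distrib, Finset.sum_sub_distrib, Finset.sum_ite_eq, if_pos hi]
  rw [Finset.sum_congr rfl e1, Finset.sum_sub_distrib, Finset.sum_sub_distrib]
  have e2 : ∑ i ∈ s, ∑ j ∈ s, (if i = j then (0 : ℝ) else x j ^ 2 * |B i j| / 2) =
      ∑ i ∈ s, ∑ j ∈ s, (if i = j then (0 : ℝ) else x i ^ 2 * |B j i| / 2) := by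
    rw [Finset.sum_comm]
    refine Finset.sum_congr rfl fun i _ => Finset.sum_congr rfl fun j _ => ?_
    by_cases hij : i = j
    · subst hij; simp
    · rw [if_neg hij, if_neg (Ne.symm hij)]
  rw [e2, ← Finset.sum_sub_distrib, ← Finset.sum_sub_distrib]
  refine Finset.sum_nonneg fun i hi => ?_
  have e3 : x i ^ 2 * B i i - ∑ j ∈ s, (if i = j then (0 : ℝ) else x i ^ 2 * |B i j| / 2)
      - ∑ j ∈ s, (if i = j then (0 : ℝ) else x i ^ 2 * |B j i| / 2) =
      x i ^ 2 * (B i i - ∑ j ∈ s, (if i = j then (0 : ℝ) else (|B i j| + |B j i|) / 2)) := by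
    rw [mul_sub, Finset.mul_sum, sub_sub, ← Finset.sum_add_distrib]
    congr 1
    refine Finset.sum_congr rfl fun j _ => ?_
    split_ifs <;> ring
  rw [e3]
  exact mul_nonneg (sq_nonneg _) (sub_nonneg.2 (h i hi))

/-- **Quantitative Gershgorin**: `Σ_iΣ_j x_ix_jB_ij ≥ Σ_i x_i²·(B_ii − Σ_{j≠i}(|B_ij| + |B_ji|)/2)`. -/
theorem form_ge_diag_sub_offdiag {ι : Type*} [DecidableEq ι] (s : Finset ι) (B : ι → ι → ℝ) (x : ι → ℝ) :
    ∑ i ∈ s, x i ^ 2 * (B i i - ∑ j ∈ s, (if i = j then (0 : ℝ) else (|B i j| + |B j i|) / 2)) ≤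
      ∑ i ∈ s, ∑ j ∈ s, x i * x j * B i j := by
  -- apply the non-negativity version to B shifted by the diagonal margins
  set μ : ι → ℝ := fun i => B i i - ∑ j ∈ s, (if i = j then (0 : ℝ) else (|B i j| + |B j i|) / 2) with hμ
  set B' : ι → ι → ℝ := fun i j => B i j - (if i = j then μ i else 0) with hB'
  have hoff : ∀ i j, i ≠ j → B' i j = B i j := fun i j hij => by rw [hB']; dsimp only; rw [if_neg hij, sub_zero]
  have hdiag : ∀ i, B' i i = B i i - μ i := fun i => by rw [hB']; dsimp only; rw [if_pos rfl]
  have h := form_nonneg_of_diag_dominant s B' x (fun i hi => by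
    rw [hdiag]
    have e : ∑ j ∈ s, (if i = j then (0 : ℝ) else (|B' i j| + |B' j i|) / 2) =
        ∑ j ∈ s, (if i = j then (0 : ℝ) else (|B i j| + |B j i|) / 2) :=
      Finset.sum_congr rfl fun j _ => by
        by_cases hij : i = j
        · rw [if_pos hij, if_pos hij]
        · rw [if_neg hij, if_neg hij, hoff i j hij, hoff j i (Ne.symm hij)]
    rw [e, hμ]; dsimp only; linarith)
  have e2 : ∑ i ∈ s, ∑ j ∈ s, x i * x j * B' i j =
      ∑ i ∈ s, ∑ j ∈ s, x i * x j * B i j - ∑ i ∈ s, x i ^ 2 * μ i := by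
    rw [← Finset.sum_sub_distrib]
    refine Finset.sum_congr rfl fun i hi => ?_
    have e3 : ∀ j ∈ s, x i * x j * B' i j = x i * x j * B i j - (if i = j then x i ^ 2 * μ i else 0) := by
      intro j _
      rw [hB']; dsimp only
      by_cases hij : i = j
      · subst hij; rw [if_pos rfl, if_pos rfl]; ring
      · rw [if_neg hij, if_neg hij]; ring
    rw [Finset.sum_congr rfl e3, Finset.sum_sub_distrib, Finset.sum_ite_eq, if_pos hi]
  rw [e2] at h
  have e4 : ∑ i ∈ s, x i ^ 2 * μ i =
      ∑ i ∈ s, x i ^ 2 * (B i i - ∑ j ∈ s, (if i = j then (0 : ℝ) else (|B i j| + |B j i|) / 2)) :=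
    Finset.sum_congr rfl fun i _ => by rw [hμ]
  linarith

/-- Bilinear bookkeeping: `Σ_k (Σ_p a_p u_p(k))/k · (Σ_q a_q T_q(k)) = Σ_p Σ_q a_p a_q Σ_k u_p(k)T_q(k)/k`. -/
theorem sum_bilinear_expand {ι : Type*} {M : ℕ} (P : Finset ι) (a : ι → ℝ) (u T : ι → St M → ℝ) :
    ∑ k : St M, (∑ p ∈ P, a p * u p k) / (k : ℕ) * (∑ q ∈ P, a q * T q k) =
      ∑ p ∈ P, ∑ q ∈ P, a p * a q * ∑ k : St M, u p k * T q k / (k : ℕ) := by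
  have e : ∀ k : St M, (∑ p ∈ P, a p * u p k) / (k : ℕ) * (∑ q ∈ P, a q * T q k) =
      ∑ p ∈ P, ∑ q ∈ P, a p * a q * (u p k * T q k / (k : ℕ)) := by
    intro k
    rw [Finset.sum_div, Finset.sum_mul_sum]
    exact Finset.sum_congr rfl fun p _ => Finset.sum_congr rfl fun q _ => by ring
  rw [Finset.sum_congr rfl fun k _ => e k, Finset.sum_comm]
  refine Finset.sum_congr rfl fun p _ => ?_
  rw [Finset.sum_comm]
  refine Finset.sum_congr rfl fun q _ => ?_
  rw [Finset.mul_sum]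

/-- Norm bookkeeping: `‖Σ_p a_pu_p + c‖² = Σ_pΣ_q a_pa_q⟨u_p,u_q⟩ + 2c·Σ_p a_p π(u_p) + c²H`. -/
theorem sum_norm_expand {ι : Type*} {M : ℕ} (P : Finset ι) (a : ι → ℝ) (u : ι → St M → ℝ) (c : ℝ) :
    ∑ k : St M, (∑ p ∈ P, a p * u p k + c) ^ 2 / (k : ℕ) =
      ∑ p ∈ P, ∑ q ∈ P, a p * a q * ∑ k : St M, u p k * u q k / (k : ℕ) +
        2 * c * ∑ p ∈ P, a p * ∑ k : St M, u p k / (k : ℕ) + c ^ 2 * ∑ k : St M, (1 : ℝ) / (k : ℕ) := by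
  have e : ∀ k : St M, (∑ p ∈ P, a p * u p k + c) ^ 2 / ((k : ℕ) : ℝ) =
      (∑ p ∈ P, a p * u p k) / (k : ℕ) * (∑ q ∈ P, a q * u q k) +
        (2 * c) * ((∑ p ∈ P, a p * u p k) / (k : ℕ)) + c ^ 2 * (1 / (k : ℕ)) := by
    intro k; ring
  rw [Finset.sum_congr rfl fun k _ => e k, Finset.sum_add_distrib, Finset.sum_add_distrib, ← Finset.mul_sum,
    ← Finset.mul_sum, sum_bilinear_expand]
  congr 1; congr 1
  -- Σ_k (Σ_p a_p u_p k)/k = Σ_p a_p Σ_k u_p k / k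
  have e2 : ∀ k : St M, (∑ p ∈ P, a p * u p k) / ((k : ℕ) : ℝ) = ∑ p ∈ P, a p * (u p k / (k : ℕ)) := by
    intro k; rw [Finset.sum_div]; exact Finset.sum_congr rfl fun p _ => by ring
  rw [Finset.sum_congr rfl fun k _ => e2 k, Finset.sum_comm]
  exact congrArg _ (Finset.sum_congr rfl fun p _ => by rw [Finset.mul_sum])

/-! ### Linear independence of the test space -/

/-- `{1} ∪ {φ_p : p ∈ P}` is linearly independent on `{1, …, M}` for a set `P` of primes `≤ M` (`M ≥ 1`). -/
theorem parityFun_indep (P : Finset ℕ) (hP : ∀ p ∈ P, p.Prime) {M : ℕ} (hM : 1 ≤ M) (hPM : ∀ p ∈ P, p ≤ M)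
    {a : ℕ → ℝ} {c : ℝ} (h : ∀ k : St M, ∑ p ∈ P, a p * parityFun p k + c = 0) :
    (∀ p ∈ P, a p = 0) ∧ c = 0 := by
  have h1 := h ⟨1, Finset.mem_Icc.2 ⟨le_rfl, hM⟩⟩
  have e1 : ∑ p ∈ P, a p * parityFun p ((⟨1, Finset.mem_Icc.2 ⟨le_rfl, hM⟩⟩ : St M) : ℕ) =
      ∑ p ∈ P, a p / p :=
    Finset.sum_congr rfl fun p hp => by
      rw [show ((⟨1, Finset.mem_Icc.2 ⟨le_rfl, hM⟩⟩ : St M) : ℕ) = 1 from rfl,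
        parityFun_of_not_dvd (hP p hp).not_dvd_one]
      ring
  rw [e1] at h1
  have haq : ∀ q ∈ P, a q = 0 := by
    intro q hq
    have hqM : q ∈ Finset.Icc 1 M := Finset.mem_Icc.2 ⟨(hP q hq).one_lt.le, hPM q hq⟩
    have h2 := h ⟨q, hqM⟩
    have e2 : ∑ p ∈ P, a p * parityFun p ((⟨q, hqM⟩ : St M) : ℕ) = ∑ p ∈ P, a p / p - a q := by
      rw [show ((⟨q, hqM⟩ : St M) : ℕ) = q from rfl, ← Finset.add_sum_erase P _ hq,
        ← Finset.add_sum_erase P (fun p => a p / (p : ℝ)) hq, parityFun_of_dvd (dvd_refl q)]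
      have e3 : ∑ p ∈ P.erase q, a p * parityFun p q = ∑ p ∈ P.erase q, a p / (p : ℝ) :=
        Finset.sum_congr rfl fun p hp => by
          have hpq : p ≠ q := Finset.ne_of_mem_erase hp
          have hpP := Finset.mem_of_mem_erase hp
          rw [parityFun_of_not_dvd (fun hdvd =>
            hpq ((Nat.prime_dvd_prime_iff_eq (hP p hpP) (hP q hq)).1 hdvd))]
          ring
      rw [e3]
      ring
    rw [e2] at h2
    linarith
  refine ⟨haq, ?_⟩
  rw [Finset.sum_eq_zero (fun p hp => by rw [haq p hp, zero_div]), zero_add] at h1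
  exact h1

end Summit.RiemannHypothesis.RiemannHypothesis.Theorems.IntegerScrew

end
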